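import Summits.QuantumFields.BalabanUV.T4Continuum.Support.NE7K1LinSchurBilinError

/-!
# NE7K1LinSchurConjEnergy — row NE7 (node U5), candidate route HOM, path H1L, cell K1-lin(s): (π6)(i) for the SCHUR member —
# THE CONJUGATED SCHUR FORM DOMINATES HALF THE SCHUR FORM, `½⟨w,Sw⟩ ≤ ⟨w,(conjW ρ_c S)w⟩`, and `S` is `σ`-coercive

Lineage `b2b-balaban-t4-ne7-p2` (CRUX PROVER NE7 #2), generation 64.  The energy-form hypothesis `hE₁` of
`NE7K1LinSchurLineDerivRelWE.inv_line_sub_inv_line_weightedE` for `P₁ = schur H`: the quadratic conjugation ERROR of a Schur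
complement is NOT small in norm (its form is of size `n²` at U = 1), but its conjugated FORM still keeps half the energy — through the
conjugated-harmonic extension: `⟨w,(conjW ρ_c S)w⟩ = ⟨E_ρw, H_ρE_ρw⟩ ≥ ½⟨E_ρw, HE_ρw⟩ = ½(⟨w,Sw⟩ + ⟨χ,Dχ⟩) ≥ ½⟨w,Sw⟩`.  [folklore]:
* `schur_coercive` : `σ‖w‖² ≤ ⟨w, (schur H) w⟩` for `σ`-coercive symmetric `H`;
* **`schur_conj_form_ge`** : `½⟨w,(schur H)w⟩ ≤ ⟨w,(conjW (ρ∘inl) (schur H))w⟩` for `H` symmetric `σ`-coercive with quadratic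
  conjugation error at `ρ` `≥ −(σ∕2)‖·‖²`;
* `schur_conj_coercive` : `(σ∕2)‖w‖² ≤ ⟨w,(conjW (ρ∘inl) (schur H))w⟩`.

HONEST FRAMING: [folklore] finite real matrices; nothing printed asserted; no `sorry`.  FIXED FINITE T⁴, rung (B)+1; NE7 NOT PRINTED ∕
NOT PROVED; spine 0∕9; NOT infinite volume, NOT mass gap, NOT Clay.  HONEST DEPENDENCY: continuum YM on T⁴ ⇐ BetaPertH ∧ nine spine
estimates (0/9 proved); BetaPertH ⇐ (D1) ∧ (D4) ∧ CAP+tail; G-an2-4 gates asym, D1 and NE2/3/4.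
-/

noncomputable section

open Finset Matrix

namespace Summit.QuantumFields.BalabanUV.T4Continuum.NE7K1LinSchurConjEnergy

open NE7K1LinSchurLineForm NE7K1LinConjW NE7K1LinSchurLineDerivRel NE7K1LinSchurHarmonicExt NE7K1LinSchurBilinError

variable {ιc ιf : Type*} [Fintype ιc] [Fintype ιf] [DecidableEq ιf]

/-- **THE SCHUR COMPLEMENT OF A COERCIVE MATRIX IS COERCIVE**: `σ‖w‖² ≤ ⟨w, (schur H) w⟩`. [folklore] -/
theorem schur_coercive (H : Matrix (ιc ⊕ ιf) (ιc ⊕ ιf) ℝ) {σ : ℝ} (hσ : 0 < σ)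
    (hH : ∀ v, σ * (v ⬝ᵥ v) ≤ v ⬝ᵥ H.mulVec v) (w : ιc → ℝ) : σ * (w ⬝ᵥ w) ≤ w ⬝ᵥ (schur H).mulVec w := by
  have hD := isUnit_D H hσ hH
  rw [← energy_hext H hD w]
  refine le_trans ?_ (hH (hext H w))
  rw [dot_hext_self]
  have : 0 ≤ (H.toBlocks₂₂)⁻¹.mulVec (H.toBlocks₂₁.mulVec w) ⬝ᵥ (H.toBlocks₂₂)⁻¹.mulVec (H.toBlocks₂₁.mulVec w) := by
    simp only [dotProduct]; exact Finset.sum_nonneg fun _ _ => mul_self_nonneg _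
  nlinarith

/-- **THE CONJUGATED SCHUR FORM DOMINATES HALF THE SCHUR FORM**: `½⟨w,(schur H)w⟩ ≤ ⟨w,(conjW (ρ∘inl) (schur H))w⟩` for `H`
symmetric, `σ`-coercive, with quadratic conjugation error at `ρ` `≥ −(σ∕2)‖·‖²`. [folklore] -/
theorem schur_conj_form_ge (H : Matrix (ιc ⊕ ιf) (ιc ⊕ ιf) ℝ) (hHs : H.IsSymm) (ρ : ιc ⊕ ιf → ℝ) {σ : ℝ} (hσ : 0 < σ)
    (hH : ∀ v, σ * (v ⬝ᵥ v) ≤ v ⬝ᵥ H.mulVec v)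
    (herr : ∀ v, -(σ / 2) * (v ⬝ᵥ v) ≤ v ⬝ᵥ (conjW ρ H).mulVec v - v ⬝ᵥ H.mulVec v) (w : ιc → ℝ) :
    (w ⬝ᵥ (schur H).mulVec w) / 2 ≤ w ⬝ᵥ (conjW (ρ ∘ Sum.inl) (schur H)).mulVec w := by
  have hD := isUnit_D H hσ hH
  obtain ⟨hDρ, _⟩ := isUnit_Dρ H ρ hσ hH herr
  -- `conjW ρ_c S = schur H_ρ` and `⟨w, schur H_ρ w⟩ = ⟨E_ρw, H_ρ E_ρw⟩`
  rw [← schur_conjW ρ H hD, ← energy_hext (conjW ρ H) hDρ w]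
  -- energy form for `H` at `ρ`, at the vector `E_ρw`
  have hen := (coercive_conjW ρ H hH herr (hext (conjW ρ H) w)).2
  refine le_trans ?_ hen
  -- `E_H(E_ρw) = E_S(w) + ⟨χ,Dχ⟩ ≥ E_S(w)`
  obtain ⟨_, hEn, _⟩ := corr_identities H hHs ρ hD hDρ w
  rw [hEn]
  have hχ : 0 ≤ (((conjW ρ H).toBlocks₂₂)⁻¹.mulVec ((conjW ρ H).toBlocks₂₁.mulVec w) -
      (H.toBlocks₂₂)⁻¹.mulVec (H.toBlocks₂₁.mulVec w)) ⬝ᵥ (H.toBlocks₂₂).mulVec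
        (((conjW ρ H).toBlocks₂₂)⁻¹.mulVec ((conjW ρ H).toBlocks₂₁.mulVec w) - (H.toBlocks₂₂)⁻¹.mulVec (H.toBlocks₂₁.mulVec w)) := by
    set χ := ((conjW ρ H).toBlocks₂₂)⁻¹.mulVec ((conjW ρ H).toBlocks₂₁.mulVec w) - (H.toBlocks₂₂)⁻¹.mulVec (H.toBlocks₂₁.mulVec w)
    have h := hH (Sum.elim 0 χ)
    rw [form_inr, dot_sumElim_self, zero_dotProduct, zero_add] at h
    have : 0 ≤ χ ⬝ᵥ χ := by simp only [dotProduct]; exact Finset.sum_nonneg fun _ _ => mul_self_nonneg _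
    nlinarith
  linarith

/-- the conjugated Schur form is `(σ∕2)`-coercive. [folklore] -/
theorem schur_conj_coercive (H : Matrix (ιc ⊕ ιf) (ιc ⊕ ιf) ℝ) (hHs : H.IsSymm) (ρ : ιc ⊕ ιf → ℝ) {σ : ℝ} (hσ : 0 < σ)
    (hH : ∀ v, σ * (v ⬝ᵥ v) ≤ v ⬝ᵥ H.mulVec v)
    (herr : ∀ v, -(σ / 2) * (v ⬝ᵥ v) ≤ v ⬝ᵥ (conjW ρ H).mulVec v - v ⬝ᵥ H.mulVec v) (w : ιc → ℝ) :
    σ / 2 * (w ⬝ᵥ w) ≤ w ⬝ᵥ (conjW (ρ ∘ Sum.inl) (schur H)).mulVec w := by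
  have h1 := schur_coercive H hσ hH w
  have h2 := schur_conj_form_ge H hHs ρ hσ hH herr w
  linarith

end Summit.QuantumFields.BalabanUV.T4Continuum.NE7K1LinSchurConjEnergy
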